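import Literature.AnabelianGeometry.SemiGraphs.MorphismRigidity
import Literature.AnabelianGeometry.Anabelioids.BasicProofs2
import Literature.AnabelianGeometry.Anabelioids.ExactFunctorProofs
import Literature.AnabelianGeometry.Anabelioids.Pi1MonoDescent
import Literature.AnabelianGeometry.SemiGraphs.BranchSubgroupLemmas
import HarnessLib

/-!
# [SemiAnbd] Remark 2.4.2, third display: rigidity of locally open morphisms — PROOF

Mochizuki, *Semi-graphs of anabelioids*, Publ. RIMS **42** (2006), §2, Remark 2.4.2, p. 26
[cite: MochizukiSemiAnbd2006, Rem. 2.4.2 p.26]: for a locally open morphism `φ` between totally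
aloof, verticially slim semi-graphs of anabelioids of injective type (every edge abutting to a
vertex), "the 1-morphism `φ` has no nontrivial automorphisms".  The statement file
`SemiGraphs/MorphismRigidity.lean` records this as the named fact `remark_2_4_2_rigid`; this
proof-only companion discharges it (`remark_2_4_2_rigid_holds`).

Proof ("it follows formally from the definitions [cf. also [Mzk4], Corollary 1.1.6]", loc. cit.):
* VERTICES.  An automorphism of `φ_v : 𝒢_v → ℋ_w` is, by [GeoAn] Cor. 1.1.6
  (`automorphisms_of_arrow_holds`), an element of the centralizer in `π₁(ℋ_w, φ_v ∘ β)` of the image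
  of `π₁(𝒢_v, β)`; that image is OPEN (`φ` locally open) and `π₁(ℋ_w, φ_v ∘ β)` is slim (`ℋ`
  verticially slim; `φ_v^* ⋙ β` is a basepoint of `ℋ_w` by `fiberFunctor_comp_of_exact`, SGA1 V 6.1),
  so the centralizer is trivial and `σ_v = 1`.
* EDGES.  For an edge `e` pick an abutting branch `b` (hypothesis `EveryEdgeAbuts`); the coherence
  of the 2-cell `σ` with `φ_b` and `σ_v = 1` give `b'^* ◁ σ_e = 1` for the branch `b' = f(b)` of `ℋ`;
  whiskering with the basepoint of `𝒢_e` turns this into `π₁(b'_*)(σ_e ⋆ β) = 1` in `π₁(ℋ_w)`, and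
  `b'_*` is a `π₁`-monomorphism (`ℋ` of injective type), so `σ_e ⋆ β = 1`, whence `σ_e = 1`
  (fibre functors are faithful).
(Total aloofness is not used by this argument; it is a hypothesis of the printed sentence.)

Proof-only: no definitions, nothing of the statement file is restated.
-/

namespace Literature.AnabelianGeometry.SemiGraphs

open CategoryTheory CategoryTheory.Limits CategoryTheory.PreGaloisCategory
open Literature.AnabelianGeometry.Anabelioids

universe v₁ u₁ u

section Tools

variable {Xc : Type u₁} [Category.{v₁} Xc] [GaloisCategory Xc]
  {Yc : Type u₁} [Category.{v₁} Yc] [GaloisCategory Yc]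
  {Zc : Type u₁} [Category.{v₁} Zc] [GaloisCategory Zc]

/-- **Rigidity at a vertex**: a morphism of connected anabelioids `φ : X → Y` with open image on
`π₁` (for every basepoint of `X`) into a slim `Y` has no nontrivial automorphism ([GeoAn] Cor. 1.1.6
+ slimness at the basepoint `φ ∘ β`). [folklore] -/
private theorem iso_eq_refl_of_isSlim_of_isOpen (φv : Anabelioids.Hom Xc Yc)
    (hY : Anabelioids.IsSlim Yc)
    (hopen : ∀ (F : Xc ⥤ FintypeCat.{v₁}) [FiberFunctor F],
      IsOpen (Set.range (pi1Map φv.pullback F)))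
    (α : φv.pullback ≅ φv.pullback) : α = Iso.refl _ := by
  let F := GaloisCategory.getFiberFunctor Xc
  obtain ⟨e⟩ := automorphisms_of_arrow_holds Xc Yc φv F
  haveI : PreservesFiniteLimits φv.pullback := φv.property.1
  haveI : PreservesFiniteColimits φv.pullback := φv.property.2
  haveI : FiberFunctor (φv.pullback ⋙ F) := fiberFunctor_comp_of_exact φv.pullback F
  have hbot : Subgroup.centralizer (Set.range (pi1Map φv.pullback F)) = ⊥ := by
    have h := (hY.isSlimGroup (φv.pullback ⋙ F)).centralizer_eq_bot (pi1Map φv.pullback F).range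
      (by rw [MonoidHom.coe_range]; exact hopen F)
    rwa [MonoidHom.coe_range] at h
  haveI : Subsingleton (φv ≅ φv) := ⟨fun a b => e.injective (Subtype.ext (by
    have ha : (e a).1 = 1 := Subgroup.mem_bot.mp (hbot.le (e a).2)
    have hb : (e b).1 = 1 := Subgroup.mem_bot.mp (hbot.le (e b).2)
    exact ha.trans hb.symm))⟩
  have h : ((exactFunctor Yc Xc).isoMk α : φv ≅ φv) = Iso.refl φv := Subsingleton.elim _ _
  exact Iso.ext (congrArg (fun β : φv ≅ φv => β.hom.hom) h)

omit [GaloisCategory Zc] in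
/-- **Rigidity along a `π₁`-monomorphism**: if `Q : E' → W` is a `π₁`-monomorphism of connected
anabelioids and an automorphism `β` of `R : E → E'` becomes trivial after whiskering with `Q^*`,
then `β` is trivial (whisker with a basepoint of `E`, apply injectivity of `π₁(Q)` at the basepoint
`R ∘ β_E`, and faithfulness of the fibre functor). [folklore] -/
private theorem iso_eq_refl_of_whiskerLeft (R : Anabelioids.Hom Xc Yc) (Q : Anabelioids.Hom Yc Zc)
    (hQ : IsPi1Mono Q.pullback) (β : R.pullback ≅ R.pullback)
    (h : Functor.isoWhiskerLeft Q.pullback β = Iso.refl _) : β = Iso.refl _ := by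
  let F := GaloisCategory.getFiberFunctor Xc
  haveI : PreservesFiniteLimits R.pullback := R.property.1
  haveI : PreservesFiniteColimits R.pullback := R.property.2
  haveI : FiberFunctor (R.pullback ⋙ F) := fiberFunctor_comp_of_exact R.pullback F
  have hcomp : ∀ B : Zc, β.hom.app (Q.pullback.obj B) = 𝟙 _ := by
    intro B
    have hB := congrArg (fun γ : Q.pullback ⋙ R.pullback ≅ Q.pullback ⋙ R.pullback => γ.hom.app B) h
    simp only [Functor.isoWhiskerLeft_hom, Functor.whiskerLeft_app, Iso.refl_hom,
      NatTrans.id_app] at hB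
    exact hB
  have hw : pi1Map Q.pullback (R.pullback ⋙ F) (Functor.isoWhiskerRight β F) = 1 := by
    apply Iso.ext
    apply NatTrans.ext
    funext B
    rw [pi1Map_hom_app, Functor.isoWhiskerRight_hom, Functor.whiskerRight_app, hcomp B, F.map_id]
    rfl
  have hw1 : Functor.isoWhiskerRight β F = (1 : Aut (R.pullback ⋙ F)) :=
    hQ (R.pullback ⋙ F) (by rw [hw, map_one])
  apply Iso.ext
  apply NatTrans.ext
  funext A
  have hA := congrArg (fun γ : Aut (R.pullback ⋙ F) => γ.hom.app A) hw1
  simp only [Functor.isoWhiskerRight_hom, Functor.whiskerRight_app] at hA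
  apply F.map_injective
  rw [hA, Iso.refl_hom, NatTrans.id_app, F.map_id]
  rfl

end Tools

namespace SemiGraphOfAnabelioids

/-- NAMED FACT `remark_2_4_2_rigid` ([SemiAnbd] Rmk 2.4.2, third display), PROVED: a 2-automorphism
of a locally open `φ : 𝒢 → ℋ` (totally aloof, verticially slim, injective type, every edge abutting
to a vertex) has identity components — vertices by Cor. 1.1.6 + slimness at the basepoint
`φ_v ∘ β`, edges by the coherence with `φ_b` and the `π₁`-injectivity of the branch morphisms of `ℋ`.
[cite: MochizukiSemiAnbd2006, Rem. 2.4.2 p.26] -/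
theorem remark_2_4_2_rigid_holds : remark_2_4_2_rigid.{v₁, u₁, u} := by
  intro 𝒢 ℋ f φ hE _hGi hHi _hGa _hHa _hGs hHs hopen σ
  have hV : ∀ v, σ.isoV v = Iso.refl _ := fun v =>
    iso_eq_refl_of_isSlim_of_isOpen (φ.φV v) (hHs.isSlim (f.vertexMap v))
      (fun F _ => hopen.1 v F) (σ.isoV v)
  refine ⟨hV, ?_⟩
  intro e e' h
  obtain ⟨b, v, hbe, hbv⟩ := hE e
  subst hbe
  have he' : e' = ℋ.graph.edgeOf (f.branchMap b) := h.symm.trans (f.edgeOf_branchMap b).symm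
  subst he'
  -- coherence with `φ_b`, with `σ_v = 1`
  have hcoh := σ.coh b v hbv
  rw [hV v] at hcoh
  have hrefl : Functor.isoWhiskerRight (Iso.refl (φ.φV v).pullback) (𝒢.pull b v hbv).pullback =
      Iso.refl _ := by
    apply Iso.ext
    rw [Functor.isoWhiskerRight_hom, Iso.refl_hom, Functor.whiskerRight_id', Iso.refl_hom]
  rw [hrefl, Iso.refl_trans] at hcoh
  have hW : Functor.isoWhiskerLeft
      (ℋ.pull (f.branchMap b) (f.vertexMap v) (f.abuts_branchMap b v hbv)).pullback
      (σ.isoE (𝒢.graph.edgeOf b) (ℋ.graph.edgeOf (f.branchMap b)) (f.edgeOf_branchMap b).symm) =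
      Iso.refl _ := by
    have h2 := congrArg (fun γ => (φ.φB b v hbv).symm ≪≫ γ) hcoh
    simp only [Iso.symm_self_id_assoc, Iso.symm_self_id] at h2
    exact h2
  exact iso_eq_refl_of_whiskerLeft (φ.φE _ _ _)
    (ℋ.pull (f.branchMap b) (f.vertexMap v) (f.abuts_branchMap b v hbv))
    (hHi.isPi1Mono _ _ _) _ hW

end SemiGraphOfAnabelioids

end Literature.AnabelianGeometry.SemiGraphs

/-! ## Part 2: [IUTchI] Remark 2.5.3 (iii) — the author's replacement for the second display of
[SemiAnbd] Remark 2.4.2, PROVED AS TYPED (`remark_2_5_3_iii_holds`)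

For a branch `b` of `e` abutting to `v` and isomorphisms `α_v : φ_v ≅ φ'_v`, the discrepancy
`δ := φ_b⁻¹ ≫ (α_v ▷ b^*) ≫ φ'_b : (f b)^* ⋙ φ_e^* ≅ (f b)^* ⋙ φ'_e^*` descends along the
`π₁`-monomorphism `(f b)^*` of `ℋ` by `Anabelioids.exists_iso_whiskerLeft_eq_of_aloof` (total
aloofness of `ℋ` at `f b`, openness of `π₁(φ_e)`), giving `β : φ_e ≅ φ'_e` with `(f b)^* ◁ β = δ`.
-/

namespace Literature.AnabelianGeometry.SemiGraphs

open CategoryTheory CategoryTheory.Limits CategoryTheory.PreGaloisCategory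
open Literature.AnabelianGeometry.Anabelioids
open scoped Pointwise

universe v₁ u₁ u


namespace SemiGraphOfAnabelioids

/-- Local openness at an edge, for an arbitrary presentation of the target edge. [folklore] -/
private theorem isOpen_range_pi1Map_φE {𝒢 ℋ : SemiGraphOfAnabelioids.{v₁, u₁, u}}
    {f : 𝒢.graph ⟶ ℋ.graph} (φ : HomOver 𝒢 ℋ f) (hopen : φ.toHom.IsLocallyOpen)
    (e : 𝒢.graph.Edge) (e' : ℋ.graph.Edge) (h : f.edgeMap e = e')
    (F : 𝒢.E e ⥤ FintypeCat.{v₁}) [FiberFunctor F] :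
    IsOpen (Set.range (pi1Map (φ.φE e e' h).pullback F)) := by
  subst h
  exact hopen.2 e F

/-- NAMED FACT `remark_2_5_3_iii` ([IUTchI] Rmk 2.5.3 (iii), the author's replacement for the
withdrawn second display of [SemiAnbd] Rmk 2.4.2), PROVED AS TYPED: for locally open `φ, φ'` over
the same morphism of underlying semi-graphs, between totally aloof semi-graphs of anabelioids of
injective type in which every edge abuts to a vertex, isomorphisms `φ_v ≅ φ'_v` of all vertex
components force isomorphisms `φ_e ≅ φ'_e` of the edge components, and `φ'_b` is `φ_b` corrected by
such isomorphisms.  Proof: for a branch `b` of `e` abutting to `v`, the discrepancy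
`δ := φ_b⁻¹ ≫ (α_v ▷ b^*) ≫ φ'_b : (f b)^* ⋙ φ_e^* ≅ (f b)^* ⋙ φ'_e^*` DESCENDS along the
`π₁`-monomorphism `(f b)^*` (`exists_iso_whiskerLeft_eq`: aloofness of `ℋ` at `f b` + openness of
`π₁(φ_e)` put the measuring element of `π₁(ℋ_{f v})` inside `Π_{f b}`), giving `β : φ_e ≅ φ'_e` with
`(f b)^* ◁ β = δ`, i.e. `φ'_b = (α_v ▷ b^*)⁻¹ ≫ φ_b ≫ ((f b)^* ◁ β)` (take `γ = 1`).
[cite: Mochizuki2012, IUTchI Rmk 2.5.3 (iii), p.54] -/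
theorem remark_2_5_3_iii_holds : remark_2_5_3_iii.{v₁, u₁, u} := by
  intro 𝒢 ℋ f φ φ' hE _hGi hHi _hGa hHa hopen _hopen' hV
  have core : ∀ (b : 𝒢.graph.Branch) (v : 𝒢.graph.Vertex) (hbv : 𝒢.graph.abuts b = some v),
      ∃ (β : (φ.φE (𝒢.graph.edgeOf b) (ℋ.graph.edgeOf (f.branchMap b))
              (f.edgeOf_branchMap b).symm).pullback ≅
            (φ'.φE (𝒢.graph.edgeOf b) (ℋ.graph.edgeOf (f.branchMap b))
              (f.edgeOf_branchMap b).symm).pullback)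
        (α : (φ.φV v).pullback ≅ (φ'.φV v).pullback),
        Functor.isoWhiskerLeft
            (ℋ.pull (f.branchMap b) (f.vertexMap v) (f.abuts_branchMap b v hbv)).pullback β =
          (φ.φB b v hbv).symm ≪≫ Functor.isoWhiskerRight α (𝒢.pull b v hbv).pullback ≪≫
            φ'.φB b v hbv := by
    intro b v hbv
    obtain ⟨α⟩ := hV v
    let R := φ.φE (𝒢.graph.edgeOf b) (ℋ.graph.edgeOf (f.branchMap b)) (f.edgeOf_branchMap b).symm
    let R' := φ'.φE (𝒢.graph.edgeOf b) (ℋ.graph.edgeOf (f.branchMap b)) (f.edgeOf_branchMap b).symm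
    let Qh := ℋ.pull (f.branchMap b) (f.vertexMap v) (f.abuts_branchMap b v hbv)
    haveI : PreservesFiniteLimits R.pullback := R.property.1
    haveI : PreservesFiniteColimits R.pullback := R.property.2
    haveI : PreservesFiniteLimits R'.pullback := R'.property.1
    haveI : PreservesFiniteColimits R'.pullback := R'.property.2
    haveI : PreservesFiniteLimits Qh.pullback := Qh.property.1
    haveI : PreservesFiniteColimits Qh.pullback := Qh.property.2
    let F := GaloisCategory.getFiberFunctor (𝒢.E (𝒢.graph.edgeOf b))
    haveI : FiberFunctor (R.pullback ⋙ F) := fiberFunctor_comp_of_exact _ _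
    haveI : FiberFunctor (R'.pullback ⋙ F) := fiberFunctor_comp_of_exact _ _
    haveI : FiberFunctor (Qh.pullback ⋙ (R.pullback ⋙ F)) := fiberFunctor_comp_of_exact _ _
    have hRopen : IsOpen (Set.range (pi1Map R.pullback F)) :=
      isOpen_range_pi1Map_φE φ hopen _ _ _ F
    have haloof : ∀ G : Aut (Qh.pullback ⋙ (R.pullback ⋙ F)),
        G ∉ (pi1Map Qh.pullback (R.pullback ⋙ F)).range →
        ((pi1Map Qh.pullback (R.pullback ⋙ F)).range ⊓
            ConjAct.toConjAct G • (pi1Map Qh.pullback (R.pullback ⋙ F)).range).relIndex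
          (pi1Map Qh.pullback (R.pullback ⋙ F)).range = 0 := by
      intro G hG
      have h := (hHa.isAloof (ℋ.graph.edgeOf (f.branchMap b)) (f.branchMap b) rfl (f.vertexMap v)
        (f.abuts_branchMap b v hbv) (Qh.pullback ⋙ (R.pullback ⋙ F)) (R.pullback ⋙ F)
        (Iso.refl _)).2 G
      rw [ℋ.branchSubgroup_refl] at h
      exact h hG
    obtain ⟨β, hβ⟩ := exists_iso_whiskerLeft_eq_of_aloof R.pullback R'.pullback Qh.pullback
      (hHi.isPi1Mono _ _ _) F hRopen haloof
      ((φ.φB b v hbv).symm ≪≫ Functor.isoWhiskerRight α (𝒢.pull b v hbv).pullback ≪≫ φ'.φB b v hbv)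
    exact ⟨β, α, hβ⟩
  constructor
  · intro e e' h
    obtain ⟨b, v, hbe, hbv⟩ := hE e
    subst hbe
    have he' : e' = ℋ.graph.edgeOf (f.branchMap b) := h.symm.trans (f.edgeOf_branchMap b).symm
    subst he'
    obtain ⟨β, -, -⟩ := core b v hbv
    exact ⟨β⟩
  · intro b v hbv
    obtain ⟨β, α, hβ⟩ := core b v hbv
    refine ⟨α, β, Iso.refl _, ?_⟩
    rw [Iso.refl_trans, hβ]
    simp only [Iso.self_symm_id_assoc, Iso.symm_self_id_assoc]

end SemiGraphOfAnabelioids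

end Literature.AnabelianGeometry.SemiGraphs
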